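import Summits.AtomisticToContinuum.BoseEinsteinCondensation.Theorems.BECGroundStateSOSLatticeODLROOffHalfFillingLadderGlue
import Literature.MathematicalPhysics.QuantumLattice.XYOrderThermalGDProofs
import Mathlib.LinearAlgebra.Matrix.Kronecker

/-!
# Crux `LatticeODLROOffHalfFilling` — the ladder line: twist positivity on even tori

Route BECGroundStateSOS, crux stmt-AtomisticToContinuum-11033, line `Sketch`, stub
`stub_twistNonneg_of_trace` of the registered skeleton (GroundSectorUnique, finite-temperature
part). For the S=½ XY Hamiltonian `H_{L,0} = Hmu L 0` on the even torus `(ℤ/Lℤ)³`, `L ≥ 4`,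
and the twist `e^{iθS³_tot} = diag(e^{iθ(L³/2 − #↓σ)})`, the abstract decorated
Dyson–Lieb–Simon positivity `Tr[(W ⊗ W̄) exp(A ⊗ 1 + 1 ⊗ Ā + Σᵢ Mᵢ ⊗ M̄ᵢ)] ≥ 0` (hypothesis
`hpos`, the neighbouring stub `stub_twistTraceNonneg`) gives
`Re Tr(e^{−βH_{L,0}} e^{iθS³_tot}) ≥ 0` for every `β ≥ 0`, `θ ∈ ℝ`:

* `exists_flip_conj` — the sublattice rotation by `π` about the `1`-axis, realised as the
  product `W = ⨂_{x odd} σˣ_x` (a permutation of spin configurations): `W H(h) Wᴴ = H♭(h)`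
  (`xyRealFieldHamiltonian`, the construction of `exists_unitary_conj_xyFieldHamiltonian`) and
  `W e^{iθS³_tot} Wᴴ = e^{iθS³_stag} = diag(e^{iθ Σ_x ε_x s(σ_x)})`, `ε_x = ±1` the sublattice
  sign, `s(↑) = ½`, `s(↓) = −½`; mirror sites of a reflection between sites have opposite sign;
* `twist_eq_submatrix` — under the tensor-square identification `torusSplit` along a pair of
  planes the staggered twist is `W_θ ⊗ W̄_θ`, `W_θ = diag(e^{iθ Σ_{x ∈ left} ε_x s(σ_x)})`;
* `stub_twistNonneg_of_trace` — unitary invariance of the trace, the Kronecker form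
  `H♭(0) = (A ⊗ 1 + 1 ⊗ A − Σ Mᵢ ⊗ Mᵢ)∘e` with real `A, Mᵢ` (`xyRealFieldHamiltonian_eq_submatrix`),
  `−βK = (−βA) ⊗ 1 + 1 ⊗ (−βA) + Σ (√βMᵢ) ⊗ (√βMᵢ)`, and `hpos`.

References: F. J. Dyson, E. H. Lieb, B. Simon, J. Stat. Phys. 18 (1978) 335–383, Lemma 4.1,
Thm. 4.2; T. Kennedy, E. H. Lieb, B. S. Shastry, J. Stat. Phys. 53 (1988) 1019–1030,
eqs. (15)–(21).
-/

noncomputable section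

namespace Summit.AtomisticToContinuum.BoseEinsteinCondensation.Theorems.LatticeODLROOffHalfFilling.Ladder

open Literature.MathematicalPhysics.QuantumLattice Literature.Probability.LatticeModels Matrix Finset
open Summit.AtomisticToContinuum.BoseEinsteinCondensation.Theorems.LatticeODLROOffHalfFilling.Negative
open scoped ComplexOrder BigOperators Kronecker

/-! ### Diagonal bookkeeping for the twist -/

section TwistAlgebra

variable {Λ : Type*} [Fintype Λ] [DecidableEq Λ]

omit [DecidableEq Λ] in
/-- A product of diagonal single-site matrices is diagonal in the product basis:
`⨂_x diag(g_x) = diag(σ ↦ ∏_x g_x(σ_x))`. [folklore] -/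
private theorem productOp_diagonal' (g : Λ → Fin 2 → ℂ) :
    productOp (fun x => diagonal (g x)) =
      (diagonal fun σ : TensorIndex Λ 2 => ∏ x, g x (σ x)) := by
  ext σ τ
  rw [productOp_apply, diagonal_apply]
  by_cases h : σ = τ
  · subst h
    rw [if_pos rfl]
    exact Finset.prod_congr rfl fun x _ => diagonal_apply_eq _ _
  · rw [if_neg h]
    obtain ⟨x, hx⟩ := Function.ne_iff.mp h
    exact Finset.prod_eq_zero (Finset.mem_univ x) (diagonal_apply_ne _ hx)

omit [DecidableEq Λ] in
/-- `Σ_x s(σ_x) = |Λ|/2 − #↓σ` (the `S³_tot`-eigenvalue of the basis state `σ`). [folklore] -/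
private theorem ofReal_sum_spinVal (σ : TensorIndex Λ 2) :
    ((∑ x, (1 / 2 - ((σ x : ℕ) : ℝ)) : ℝ) : ℂ) = (Fintype.card Λ : ℂ) / 2 - (downCount σ : ℂ) := by
  have hv : ∀ b : Fin 2, (((b : ℕ) : ℝ) : ℂ) = if b = 1 then 1 else 0 := by
    intro b; fin_cases b <;> simp
  push_cast
  rw [Finset.sum_sub_distrib, Finset.sum_const, Finset.card_univ, nsmul_eq_mul, downCount,
    Finset.natCast_card_filter]
  congr 1
  · ring
  · exact Finset.sum_congr rfl fun x _ => hv (σ x)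

omit [DecidableEq Λ] in
/-- The product of the single-site phases `e^{iθ c_x s(σ_x)}` is `e^{iθ Σ_x c_x s(σ_x)}`.
[folklore] -/
private theorem prod_cexp_spinVal (θ : ℝ) (c : Λ → ℝ) (σ : TensorIndex Λ 2) :
    ∏ x, Complex.exp (Complex.I * (θ : ℂ) * ((c x * (1 / 2 - ((σ x : ℕ) : ℝ)) : ℝ) : ℂ)) =
      Complex.exp (Complex.I * (θ : ℂ) * ((∑ x, c x * (1 / 2 - ((σ x : ℕ) : ℝ)) : ℝ) : ℂ)) := by
  rw [← Complex.exp_sum, ← Finset.mul_sum, ← Complex.ofReal_sum]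

/-- Conjugating a diagonal spin-½ matrix by `σˣ` swaps its two entries. [folklore] -/
private theorem pauliX_conj_diagonal (p : Fin 2 → ℂ) :
    spinHalfPauli 0 * diagonal p * (spinHalfPauli 0)ᴴ =
      diagonal (fun a => if a = 0 then p 1 else p 0) := by
  ext i j
  simp only [Matrix.mul_apply, conjTranspose_apply, diagonal_apply, Fin.sum_univ_two]
  fin_cases i <;> fin_cases j <;> simp [spinHalfPauli]

/-- The swapped phases are the phases of the opposite sign: `s(1 − a) = −s(a)`. [folklore] -/
private theorem swap_phase (θ : ℝ) (a : Fin 2) :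
    (if a = 0 then
        Complex.exp (Complex.I * (θ : ℂ) * ((1 * (1 / 2 - (((1 : Fin 2) : ℕ) : ℝ)) : ℝ) : ℂ))
      else
        Complex.exp (Complex.I * (θ : ℂ) * ((1 * (1 / 2 - (((0 : Fin 2) : ℕ) : ℝ)) : ℝ) : ℂ))) =
      Complex.exp (Complex.I * (θ : ℂ) * ((-1 * (1 / 2 - ((a : ℕ) : ℝ)) : ℝ) : ℂ)) := by
  fin_cases a <;> simp <;> norm_num

end TwistAlgebra

/-! ### The sublattice flip on the even torus -/

section Flip

variable (L : ℕ) [NeZero L]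

/-- **The sublattice rotation and the twist.** On the even torus of side `L ≥ 3` the rotation
by `π` about the `1`-axis on the odd sublattice, realised as `W = ⨂_{x odd} σˣ_x`, is a unitary
with `W H(h) Wᴴ = H♭(h)` for every field `h` ([KLS1988JSP] eqs. (15)–(17), the construction of
`exists_unitary_conj_xyFieldHamiltonian` for spin ½) which maps the twist `e^{iθS³_tot}` to
the staggered twist `diag(e^{iθ Σ_x ε_x s(σ_x)})` with the sublattice sign `ε_x = ±1`; mirror
sites of every reflection between sites have opposite sign.
[cite: KLS1988JSP, eqs. (15)–(21)] [cite: DysonLiebSimon1978, Lemma 4.1, Thm. 4.2] -/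
private theorem exists_flip_conj (hLe : Even L) (hL3 : 3 ≤ L) :
    ∃ (W : Op (TorusSite 3 L) 2) (s : TorusSite 3 L → ℝ),
      W * Wᴴ = 1 ∧ Wᴴ * W = 1 ∧
      (∀ h : TorusSite 3 L → ℝ,
        W * xyFieldHamiltonian L 1 h * Wᴴ = xyRealFieldHamiltonian L 1 h) ∧
      (∀ (j : Fin 3) (a : ZMod L) (x : TorusSite 3 L),
        s (Torus.reflectBetweenSites j a x) = -s x) ∧
      ∀ θ : ℝ, W * Matrix.diagonal (fun σ : TensorIndex (TorusSite 3 L) 2 =>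
          Complex.exp (Complex.I * (θ : ℂ) * ((L : ℂ) ^ 3 / 2 - (downCount σ : ℂ)))) * Wᴴ =
        Matrix.diagonal (fun σ : TensorIndex (TorusSite 3 L) 2 =>
          Complex.exp (Complex.I * (θ : ℂ) * ((∑ x, s x * (1 / 2 - ((σ x : ℕ) : ℝ)) : ℝ) : ℂ))) := by
  obtain ⟨k, rfl⟩ : ∃ k, L = 2 * k := ⟨L / 2, by obtain ⟨k, hk⟩ := hLe; omega⟩
  set Ed := (torusGraph 3 (2 * k)).edgeFinset with hEd
  -- parity, the flip and the sublattice sign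
  set ε : TorusSite 3 (2 * k) → ZMod 2 := fun x =>
    ∑ j, ZMod.castHom (dvd_mul_right 2 k) (ZMod 2) (x j) with hε
  set u : TorusSite 3 (2 * k) → Matrix (Fin 2) (Fin 2) ℂ :=
    fun z => if ε z = 0 then 1 else spinHalfPauli 0 with hu
  set s : TorusSite 3 (2 * k) → ℝ := fun z => if ε z = 0 then 1 else -1 with hsdef
  set sgn : TorusSite 3 (2 * k) → ℂ := fun z => if ε z = 0 then 1 else -1 with hsgn
  have h01 : ∀ t : ZMod 2, t = 0 ∨ t = 1 := by decide
  have hua : ∀ z, u z * (u z)ᴴ = 1 := by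
    intro z; simp only [hu]; split_ifs
    · rw [conjTranspose_one, Matrix.mul_one]
    · exact pauliX_mul_conjTranspose
  have hua' : ∀ z, (u z)ᴴ * u z = 1 := by
    intro z; simp only [hu]; split_ifs
    · rw [conjTranspose_one, Matrix.mul_one]
    · exact pauliX_conjTranspose_mul
  have hux : ∀ z, u z * spinX 1 * (u z)ᴴ = spinX 1 := by
    intro z; simp only [hu]; split_ifs
    · rw [conjTranspose_one, Matrix.mul_one, Matrix.one_mul]
    · have h := pauliX_conj_spinVec 0
      rw [if_pos rfl, one_smul] at h
      exact h
  have huy : ∀ z, u z * spinY 1 * (u z)ᴴ = sgn z • spinY 1 := by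
    intro z; simp only [hu, hsgn]; split_ifs
    · rw [conjTranspose_one, Matrix.mul_one, Matrix.one_mul, one_smul]
    · have h := pauliX_conj_spinVec 1
      rw [if_neg (show (1 : Fin 3) ≠ 0 by decide)] at h
      exact h
  have hedge : ∀ e ∈ Ed, ∀ x y, e = s(x, y) → sgn x * sgn y = -1 := by
    intro e he x y hexy
    subst hexy
    rw [hEd, SimpleGraph.mem_edgeFinset, SimpleGraph.mem_edgeSet, torusGraph_adj_iff] at he
    have key : ∀ x' : TorusSite 3 (2 * k), ∀ i, sgn x' * sgn (x' + Pi.single i 1) = -1 := by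
      intro x' i
      have hpar : ε (x' + Pi.single i 1) = ε x' + 1 := torusParity_add_single k x' i
      simp only [hsgn, hpar]
      rcases h01 (ε x') with h0 | h1
      · rw [if_pos h0, if_neg (by rw [h0]; decide), one_mul]
      · rw [if_neg (by rw [h1]; decide), if_pos (by rw [h1]; decide), mul_one]
    obtain ⟨-, ⟨i, rfl⟩ | ⟨i, rfl⟩⟩ := he
    · exact key x i
    · rw [mul_comm]; exact key y i
  set W := productOp u with hW
  have hWx : ∀ x : TorusSite 3 (2 * k), W * siteSpin 1 x 0 * Wᴴ = siteSpin 1 x 0 := by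
    intro x
    rw [hW, productOp_conj_siteSpin hua, spinVec_zero, hux]
    rfl
  have hb0 : ∀ x y : TorusSite 3 (2 * k), W * spinBond 1 0 x y * Wᴴ = spinBond 1 0 x y := by
    intro x y
    rw [hW, productOp_conj_spinBond hua hua', spinVec_zero, hux, hux, spinBond]
    rfl
  have hb1 : ∀ x y : TorusSite 3 (2 * k), sgn x * sgn y = -1 →
      W * spinBond 1 1 x y * Wᴴ = -spinBond 1 1 x y := by
    intro x y hxy
    rw [hW, productOp_conj_spinBond hua hua', spinVec_one, huy, huy, onSite_smul', onSite_smul',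
      smul_mul_smul_comm, smul_mul_smul_comm, mul_comm (sgn y) (sgn x), hxy, spinBond]
    simp only [neg_smul, one_smul]
    rw [← neg_add, smul_neg]
    rfl
  have hW1 : W * (1 : Op (TorusSite 3 (2 * k)) 2) * Wᴴ = 1 := by
    rw [Matrix.mul_one, hW, productOp_mul_conjTranspose hua]
  refine ⟨W, s, productOp_mul_conjTranspose hua, productOp_conjTranspose_mul hua', fun h => ?_,
    fun j a x => ?_, fun θ => ?_⟩
  · -- conjugate the edge sum
    rw [xyFieldHamiltonian_eq_edgeSum (2 * k) hL3, xyRealFieldHamiltonian, ← hEd, Finset.mul_sum,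
      Finset.sum_mul]
    refine sum_congr rfl fun e he => ?_
    induction e using Sym2.ind with
    | h x y =>
      have hs := hedge _ he x y rfl
      simp only [Sym2.lift_mk, xyRealBond, Matrix.mul_add, Matrix.add_mul, Matrix.mul_sub,
        Matrix.sub_mul, Matrix.mul_neg, Matrix.neg_mul, Matrix.mul_smul, Matrix.smul_mul, hb0,
        hb1 x y hs, hW1, hWx]
      abel
  · -- mirror sites have opposite parity
    have hθ : Torus.reflectBetweenSites j a x = x + Pi.single j (2 * a + 1 - 2 * x j) := by
      ext i
      rw [Torus.reflectBetweenSites_apply, Pi.add_apply]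
      by_cases hi : i = j
      · subst hi; rw [Function.update_self, Pi.single_eq_same]; ring
      · rw [Function.update_of_ne hi, Pi.single_eq_of_ne hi, add_zero]
    have hpar : ε (Torus.reflectBetweenSites j a x) = ε x + 1 := by
      simp only [hε, hθ, Pi.add_apply, map_add, sum_add_distrib, add_right_inj]
      rw [← map_sum, sum_pi_single' j _ univ, if_pos (mem_univ j), map_sub, map_add, map_mul,
        map_mul, map_one, map_ofNat]
      have h2 : (2 : ZMod 2) = 0 := by decide
      rw [h2, zero_mul, zero_mul, zero_add, sub_zero]
    simp only [hsdef, hpar]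
    rcases h01 (ε x) with h0 | h1
    · rw [if_pos h0, if_neg (by rw [h0]; decide)]
    · rw [if_pos (by rw [h1]; decide), if_neg (by rw [h1]; decide), neg_neg]
  · -- the twist: `e^{iθS³_tot} = ⨂_x diag(e^{iθ/2}, e^{-iθ/2})`, flipped on the odd sublattice
    have hcard : ((2 * k : ℕ) : ℂ) ^ 3 = (Fintype.card (TorusSite 3 (2 * k)) : ℂ) := by
      have : Fintype.card (TorusSite 3 (2 * k)) = (2 * k) ^ 3 := by simp [ZMod.card]
      rw [this]; push_cast; ring
    have hD : Matrix.diagonal (fun σ : TensorIndex (TorusSite 3 (2 * k)) 2 =>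
        Complex.exp (Complex.I * (θ : ℂ) * (((2 * k : ℕ) : ℂ) ^ 3 / 2 - (downCount σ : ℂ)))) =
        productOp (fun _ : TorusSite 3 (2 * k) => diagonal (fun b : Fin 2 =>
          Complex.exp (Complex.I * (θ : ℂ) * ((1 * (1 / 2 - ((b : ℕ) : ℝ)) : ℝ) : ℂ)))) := by
      rw [productOp_diagonal']
      refine congr_arg diagonal (funext fun σ => ?_)
      rw [prod_cexp_spinVal, hcard, ← ofReal_sum_spinVal]
      simp only [one_mul]
    have hloc : (fun x => u x * diagonal (fun b : Fin 2 =>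
        Complex.exp (Complex.I * (θ : ℂ) * ((1 * (1 / 2 - ((b : ℕ) : ℝ)) : ℝ) : ℂ))) * (u x)ᴴ) =
        fun x => diagonal (fun b : Fin 2 =>
          Complex.exp (Complex.I * (θ : ℂ) * ((s x * (1 / 2 - ((b : ℕ) : ℝ)) : ℝ) : ℂ))) := by
      funext x
      simp only [hu, hsdef]
      split_ifs
      · rw [conjTranspose_one, Matrix.mul_one, Matrix.one_mul]
      · rw [pauliX_conj_diagonal]
        exact congr_arg diagonal (funext fun b => swap_phase θ b)
    rw [hD, hW, productOp_conjTranspose, productOp_mul, productOp_mul, hloc, productOp_diagonal']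
    exact congr_arg diagonal (funext fun σ => prod_cexp_spinVal θ s σ)

end Flip

/-! ### The staggered twist is `W_θ ⊗ W̄_θ` along every pair of planes -/

section Factor

variable (L : ℕ) [NeZero L] (j : Fin 3) (a : ZMod L)

/-- **The rotated twist factorises.** Under the tensor-square identification `torusSplit` along
the planes `(j, a)`, a diagonal phase matrix `diag(e^{iθ Σ_x s_x s(σ_x)})` whose weights change
sign under the reflection, `s_{θx} = −s_x`, is `W_θ ⊗ W̄_θ` with
`W_θ = diag(e^{iθ Σ_{x ∈ left} s_x s(σ_x)})` (the reflected half carries the conjugate phases).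
[cite: DysonLiebSimon1978, Thm. 4.2] -/
private theorem twist_eq_submatrix (hLe : Even L) (θ : ℝ) (s : TorusSite 3 L → ℝ)
    (hs : ∀ x, s (Torus.reflectBetweenSites j a x) = -s x) :
    Matrix.diagonal (fun σ : TensorIndex (TorusSite 3 L) 2 =>
        Complex.exp (Complex.I * (θ : ℂ) * ((∑ x, s x * (1 / 2 - ((σ x : ℕ) : ℝ)) : ℝ) : ℂ))) =
      ((Matrix.diagonal (fun τ : TensorIndex (torusLeftHalf L j a) 2 =>
          Complex.exp (Complex.I * (θ : ℂ) *
            ((∑ y : torusLeftHalf L j a, s y * (1 / 2 - ((τ y : ℕ) : ℝ)) : ℝ) : ℂ)))) ⊗ₖ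
        (Matrix.diagonal (fun τ : TensorIndex (torusLeftHalf L j a) 2 =>
          Complex.exp (Complex.I * (θ : ℂ) *
            ((∑ y : torusLeftHalf L j a, s y * (1 / 2 - ((τ y : ℕ) : ℝ)) : ℝ) : ℂ))))ᴴᵀ).submatrix
        (torusSplit L j a hLe) (torusSplit L j a hLe) := by
  rw [diagonal_conjTranspose, diagonal_transpose, diagonal_kronecker_diagonal,
    submatrix_diagonal_equiv]
  refine congr_arg diagonal (funext fun σ => ?_)
  simp only [Function.comp_apply, Pi.star_apply, torusSplit_apply_fst, torusSplit_apply_snd]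
  rw [Complex.star_def, ← Complex.exp_conj, ← Complex.exp_add]
  congr 1
  simp only [map_mul, Complex.conj_I, Complex.conj_ofReal]
  have hrefl : ∑ y : torusLeftHalf L j a, s (Torus.reflectBetweenSites j a y) *
      (1 / 2 - ((σ (Torus.reflectBetweenSites j a y) : ℕ) : ℝ)) =
      -∑ y : torusLeftHalf L j a,
        s y * (1 / 2 - ((σ (Torus.reflectBetweenSites j a y) : ℕ) : ℝ)) := by
    rw [← Finset.sum_neg_distrib]
    exact Finset.sum_congr rfl fun y _ => by rw [hs, neg_mul]
  rw [sum_sites_split L j a hLe (fun x => s x * (1 / 2 - ((σ x : ℕ) : ℝ))),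
    ← Finset.sum_coe_sort (torusLeftHalf L j a), ← Finset.sum_coe_sort (torusLeftHalf L j a),
    hrefl]
  push_cast
  ring

end Factor

/-! ### The stub: twist positivity at positive temperature -/

/-- `e^{−β K∘e} = (e^{−βK})∘e`: the Gibbs weight commutes with reindexing along an equivalence.
[folklore] -/
private theorem gibbsWeight_submatrix_equiv {l m : Type*} [Fintype l] [Fintype m] [DecidableEq l]
    [DecidableEq m] (β : ℝ) (K : Matrix m m ℂ) (e : l ≃ m) :
    Matrix.gibbsWeight β (K.submatrix e e) = (Matrix.gibbsWeight β K).submatrix e e := by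
  rw [Matrix.gibbsWeight, Matrix.gibbsWeight,
    show -(β : ℂ) • K.submatrix e e = (-(β : ℂ) • K).submatrix e e from rfl,
    Matrix.exp_submatrix_equiv]

/-- **Twist positivity on even tori.** From decorated DLS positivity: for the S=½ XY model on
`(ℤ/Lℤ)³`, `L ≥ 4` even, `Re Tr(e^{−βH_{L,0}} e^{iθS³_tot}) ≥ 0` for all `β ≥ 0`, `θ ∈ ℝ`
(`e^{iθS³_tot}` written as the diagonal matrix of phases `e^{iθ(L³/2 − #↓σ)}`). Reflection
positivity: after the sublattice rotation (`exists_flip_conj`, the construction of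
`exists_unitary_conj_xyFieldHamiltonian`) `H_{L,0}` is the Kronecker form `A⊗1 + 1⊗A − ΣMᵢ⊗Mᵢ`
with real `A, Mᵢ` (`xyRealFieldHamiltonian_eq_submatrix`, field `h = 0`) and the rotated twist
`e^{iθS³_stag}` is `W_θ ⊗ W̄_θ` (mirror sites have opposite parity, `twist_eq_submatrix`); the
trace is invariant under the rotation and the reindexing, and `hpos` applies to
`−βK = (−βA) ⊗ 1 + 1 ⊗ (−βA) + Σ (√βMᵢ) ⊗ (√βMᵢ)`.
[cite: DysonLiebSimon1978, Lemma 4.1, Thm. 4.2] -/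
theorem stub_twistNonneg_of_trace
    (hpos : ∀ {m ι : Type} [Fintype m] [DecidableEq m] [Fintype ι]
      (A W : Matrix m m ℂ) (M : ι → Matrix m m ℂ),
      0 ≤ (((W ⊗ₖ Wᴴᵀ) * NormedSpace.exp (A ⊗ₖ (1 : Matrix m m ℂ) + (1 : Matrix m m ℂ) ⊗ₖ Aᴴᵀ +
        ∑ i, M i ⊗ₖ (M i)ᴴᵀ)).trace).re)
    (L : ℕ) [NeZero L] (hL : 4 ≤ L) (hE : Even L) (β θ : ℝ) (hβ : 0 ≤ β) :
    0 ≤ ((Matrix.gibbsWeight β (Hmu L 0) *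
      Matrix.diagonal (fun σ : TensorIndex (TorusSite 3 L) 2 =>
        Complex.exp (Complex.I * (θ : ℂ) * ((L : ℂ) ^ 3 / 2 - (downCount σ : ℂ))))).trace).re := by
  have hL3 : 3 ≤ L := by omega
  obtain ⟨W, s, hWW, hWW', hWH, hs, hWD⟩ := exists_flip_conj L hE hL3
  -- the pair of planes
  set j : Fin 3 := 0 with hj
  set a : ZMod L := 0 with ha
  set A := xyLeftHamiltonian L j a hE 1 0 with hA
  set M := xyCrossOp L j a hE 1 0 with hM
  set e := torusSplit (q := 2) L j a hE with he
  -- (1) `H_{L,0} = H(0)`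
  have hH0 : Hmu L 0 = xyFieldHamiltonian L 1 0 := by
    rw [xyFieldHamiltonian_zero, Hmu, Complex.ofReal_zero, zero_smul, sub_zero]
  -- (2) unitary invariance of the trace
  have hunit : IsUnit W :=
    (Matrix.isUnit_iff_isUnit_det W).2 (Matrix.isUnit_det_of_right_inverse hWW)
  have hinv : W⁻¹ = Wᴴ := Matrix.inv_eq_right_inv hWW
  have key : ∀ H D : Op (TorusSite 3 L) 2, (Matrix.gibbsWeight β H * D).trace =
      (Matrix.gibbsWeight β (W * H * Wᴴ) * (W * D * Wᴴ)).trace := by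
    intro H D
    rw [Matrix.gibbsWeight, Matrix.gibbsWeight, ← hinv,
      show -(β : ℂ) • (W * H * W⁻¹) = W * (-(β : ℂ) • H) * W⁻¹ by
        rw [Matrix.mul_smul, Matrix.smul_mul],
      Matrix.exp_conj _ _ hunit, hinv,
      show W * NormedSpace.exp (-(β : ℂ) • H) * Wᴴ * (W * D * Wᴴ) =
          W * (NormedSpace.exp (-(β : ℂ) • H) * D) * Wᴴ by
        simp only [Matrix.mul_assoc]
        rw [← Matrix.mul_assoc Wᴴ W (D * Wᴴ), hWW', Matrix.one_mul],
      Matrix.trace_mul_cycle W, hWW', Matrix.one_mul]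
  -- (3) the Kronecker form of `H♭(0)` along the planes `(j, a)`
  have hK : xyRealFieldHamiltonian L 1 0 =
      (A ⊗ₖ (1 : Op (torusLeftHalf L j a) 2) + (1 : Op (torusLeftHalf L j a) 2) ⊗ₖ A -
        ∑ i, M i ⊗ₖ M i).submatrix e e :=
    xyRealFieldHamiltonian_eq_submatrix L j a hE 1 0
  -- (4) reality of `A`, `Mᵢ`
  have hAt : (-(β : ℂ) • A)ᵀ = (-(β : ℂ) • A)ᴴ := by
    have h := transpose_eq_conjTranspose_ofReal_smul
      (xyLeftHamiltonian_transpose_eq L j a 1 hE 0) (-β)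
    rwa [Complex.ofReal_neg] at h
  have hAbar : (-(β : ℂ) • A)ᴴᵀ = -(β : ℂ) • A := by
    rw [← hAt, transpose_transpose]
  have hMbar : ∀ i, ((Real.sqrt β : ℂ) • M i)ᴴᵀ = (Real.sqrt β : ℂ) • M i := fun i => by
    rw [← transpose_eq_conjTranspose_ofReal_smul (xyCrossOp_transpose_eq L j a 1 hE 0 i) _,
      transpose_transpose]
  -- assemble
  rw [key, hH0, hWH, hWD θ, hK, twist_eq_submatrix L j a hE θ s (hs j a),
    gibbsWeight_submatrix_equiv, submatrix_mul_equiv, Matrix.trace_submatrix_equiv,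
    Matrix.gibbsWeight, Literature.Barriers.AtomisticToContinuum.BoseGas.neg_smul_kroneckerForm hβ,
    Matrix.trace_mul_comm]
  set Wθ : Op (torusLeftHalf L j a) 2 :=
    Matrix.diagonal (fun τ : TensorIndex (torusLeftHalf L j a) 2 =>
      Complex.exp (Complex.I * (θ : ℂ) *
        ((∑ y : torusLeftHalf L j a, s y * (1 / 2 - ((τ y : ℕ) : ℝ)) : ℝ) : ℂ))) with hWθ
  have h := hpos (-(β : ℂ) • A) Wθ (fun i => (Real.sqrt β : ℂ) • M i)
  simp only [hAbar, hMbar] at h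
  exact h

end Summit.AtomisticToContinuum.BoseEinsteinCondensation.Theorems.LatticeODLROOffHalfFilling.Ladder

end
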